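import Mathlib

/-!
# ValiantsHypothesis / LacunarySymmetroid — crux `MatrixDescartes` (stmt-ValiantsHypothesis-18050), line
# `lorentzian_shadow` :: `stub_detLorentzian`, clause (d) for `K = 2`: the NEWTON WINDOW of a real-rooted polynomial

Helper file (`--supports stmt-ValiantsHypothesis-18050 --as helper`; cell val-lit, seat val-lit-p5 g9, merged desk
RULINGS #90/#91 [L4]).  Closes NO item; Mathlib-only, theorem-only.  «V1 line helper; `MatrixDescartes` /
Conjecture B / `VP ≠ VNP` OPEN.»

For a real polynomial `p` with all roots real (`#roots = natDegree`, counted with multiplicity) and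
`1 ≤ k ≤ natDegree p - 1`, NEWTON'S INEQUALITY in the factorial normalisation of the line's `hessAt`:
**`coeff (k-1) · coeff (k+1) · (k-1)! (k+1)! (m-k+1)! (m-k-1)! ≤ (coeff k · k! (m-k)!)²`** (`m = natDegree p`).
Proof = Rolle reduction to a quadratic: `p ↦ p^{(k-1)} ↦ reverse ↦ (·)^{(m-k-1)}` preserves real-rootedness
(`Polynomial.card_roots_le_derivative`; the reverse of a split polynomial with nonzero constant term splits), and a
real-rooted quadratic has nonnegative discriminant; the coefficient bookkeeping is `coeff_iterate_derivative` /
`coeff_reverse`.  With `…PencilTwoRealRooted` (real-rootedness of `t ↦ det (t A₀ + A₁)` for `A₀, A₁ ≻ 0`) this gives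
clause (d) of `IsLorentzianArray m 2 (detArray m 2 A)` (file `…PencilTwo`).

* `card_roots_derivative_eq`, `card_roots_iterate_derivative_eq` — real-rootedness survives differentiation;
* `reverse_eq_of_card_roots_eq`, `card_roots_reverse_eq` — and reversal (constant term `≠ 0`);
* `coeff_one_sq_ge_of_card_roots_eq_two` — a real-rooted quadratic has `b² ≥ 4ac`;
* **`newton_window`** — the inequality above.
-/

set_option linter.dupNamespace false

namespace Summit.ValiantsHypothesis.ValiantsHypothesis.Theorems.LacunarySymmetroidMatrixDescartes

open Polynomial

namespace NewtonWindow

/-! ## 1. Real-rootedness is preserved by differentiation -/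

/-- If `p` has `natDegree p` real roots (with multiplicity), so does `p'`. -/
theorem card_roots_derivative_eq (p : ℝ[X]) (h : Multiset.card p.roots = p.natDegree) :
    Multiset.card (derivative p).roots = (derivative p).natDegree := by
  rcases Nat.eq_zero_or_pos p.natDegree with h0 | hpos
  · rw [derivative_of_natDegree_zero h0, roots_zero, natDegree_zero, Multiset.card_zero]
  · have h1 := card_roots_le_derivative p
    have h2 := card_roots' (derivative p)
    have h3 := natDegree_derivative_le p
    omega

/-- Iterated version. -/
theorem card_roots_iterate_derivative_eq (p : ℝ[X]) (h : Multiset.card p.roots = p.natDegree) (k : ℕ) :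
    Multiset.card (derivative^[k] p).roots = (derivative^[k] p).natDegree := by
  induction k with
  | zero => simpa using h
  | succ k ih => rw [Function.iterate_succ_apply']; exact card_roots_derivative_eq _ ih

/-- Exact degree of an iterated derivative in characteristic zero (when it does not vanish by degree). -/
theorem natDegree_iterate_derivative_eq (p : ℝ[X]) (k : ℕ) (hk : k ≤ p.natDegree) :
    (derivative^[k] p).natDegree = p.natDegree - k := by
  rcases eq_or_ne p 0 with rfl | hp
  · simp [iterate_map_zero]
  refine le_antisymm (natDegree_iterate_derivative p k) (le_natDegree_of_ne_zero ?_)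
  rw [coeff_iterate_derivative, Nat.sub_add_cancel hk, nsmul_eq_mul]
  refine mul_ne_zero ?_ (leadingCoeff_ne_zero.mpr hp)
  exact_mod_cast (Nat.descFactorial_pos.mpr hk).ne'

/-! ## 2. Real-rootedness is preserved by reversal -/

/-- The reverse of a split real polynomial with nonzero constant term, explicitly: if
`p = C a · ∏ (X - r)` over its roots then `reverse p = C (a · ∏ (-r)) · ∏ (X - r⁻¹)`. -/
theorem reverse_eq_of_card_roots_eq (p : ℝ[X]) (h : Multiset.card p.roots = p.natDegree) (h0 : p.coeff 0 ≠ 0) :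
    p.reverse = C (p.leadingCoeff * (p.roots.map fun r => -r).prod) *
      (p.roots.map fun r => X - C r⁻¹).prod := by
  have hroots : ∀ r ∈ p.roots, r ≠ 0 := by
    intro r hr hr0
    have hp : p ≠ 0 := fun hp => by simp [hp] at h0
    have := (mem_roots hp).mp hr
    rw [hr0, IsRoot, ← coeff_zero_eq_eval_zero] at this
    exact h0 this
  -- reverse of a product of linear factors
  have hrev : ∀ s : Multiset ℝ, (∀ r ∈ s, r ≠ 0) →
      ((s.map fun r => X - C r).prod).reverse = C ((s.map fun r => -r).prod) * (s.map fun r => X - C r⁻¹).prod := by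
    intro s
    induction s using Multiset.induction_on with
    | empty => intro; simpa using reverse_C (1 : ℝ)
    | cons r s ih =>
      intro hs
      have hr : r ≠ 0 := hs r (Multiset.mem_cons_self r s)
      rw [Multiset.map_cons, Multiset.prod_cons, reverse_mul_of_domain, ih fun x hx => hs x (Multiset.mem_cons_of_mem hx),
        Multiset.map_cons, Multiset.prod_cons, Multiset.map_cons, Multiset.prod_cons]
      have hX1 : (X : ℝ[X]).reverse = 1 := by
        rw [show (X : ℝ[X]) = X * C 1 by simp, reverse_X_mul, reverse_C, C_1]
      have hlin : (X - C r : ℝ[X]).reverse = C (-r) * (X - C r⁻¹) := by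
        rw [sub_eq_add_neg, ← C_neg, reverse_add_C, natDegree_X, pow_one, hX1, mul_sub, ← C_mul,
          show -r * r⁻¹ = -1 by rw [neg_mul, mul_inv_cancel₀ hr]]
        simp only [C_neg, C_1]
        ring
      rw [hlin, map_mul C]
      ring
  conv_lhs => rw [← C_leadingCoeff_mul_prod_multiset_X_sub_C h]
  rw [reverse_mul_of_domain, reverse_C, hrev p.roots hroots, map_mul C]
  ring

/-- If `p` has `natDegree p` real roots and nonzero constant term, then so does `reverse p`
(same degree, inverted roots). -/
theorem card_roots_reverse_eq (p : ℝ[X]) (h : Multiset.card p.roots = p.natDegree) (h0 : p.coeff 0 ≠ 0) :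
    Multiset.card p.reverse.roots = p.reverse.natDegree ∧ p.reverse.natDegree = p.natDegree := by
  have hp : p ≠ 0 := fun hp => by simp [hp] at h0
  have hdeg : p.reverse.natDegree = p.natDegree := by
    have := natDegree_eq_reverse_natDegree_add_natTrailingDegree p
    rw [natTrailingDegree_eq_zero.mpr (Or.inr h0)] at this
    omega
  refine ⟨?_, hdeg⟩
  have hroots : ∀ r ∈ p.roots, r ≠ 0 := by
    intro r hr hr0
    have := (mem_roots hp).mp hr
    rw [hr0, IsRoot, ← coeff_zero_eq_eval_zero] at this
    exact h0 this
  have hc : p.leadingCoeff * (p.roots.map fun r => -r).prod ≠ 0 := by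
    refine mul_ne_zero (leadingCoeff_ne_zero.mpr hp) (Multiset.prod_ne_zero fun hmem => ?_)
    obtain ⟨r, hr, hr0⟩ := Multiset.mem_map.mp hmem
    exact hroots r hr (neg_eq_zero.mp hr0)
  rw [hdeg, reverse_eq_of_card_roots_eq p h h0, roots_C_mul _ hc,
    show (p.roots.map fun r => X - C r⁻¹) = (p.roots.map (·⁻¹)).map (fun a => X - C a) by
      rw [Multiset.map_map]; rfl,
    roots_multiset_prod_X_sub_C, Multiset.card_map, h]

/-! ## 3. A real-rooted quadratic has nonnegative discriminant -/

/-- If a real polynomial of degree exactly `2` has two real roots (with multiplicity), then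
`4 · a · c ≤ b²` for its coefficients. -/
theorem four_mul_le_sq_of_card_roots_eq (q : ℝ[X]) (hdeg : q.natDegree = 2)
    (h : Multiset.card q.roots = q.natDegree) : 4 * q.coeff 2 * q.coeff 0 ≤ (q.coeff 1) ^ 2 := by
  have hq : q ≠ 0 := by rintro rfl; simp at hdeg
  have hne : q.roots ≠ 0 := by
    intro h0; rw [h0, Multiset.card_zero, hdeg] at h; exact absurd h (by norm_num)
  obtain ⟨x, hx⟩ := Multiset.exists_mem_of_ne_zero hne
  have hroot : q.eval x = 0 := (mem_roots hq).mp hx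
  have hexp : q.eval x = q.coeff 2 * (x * x) + q.coeff 1 * x + q.coeff 0 := by
    rw [eval_eq_sum_range, hdeg]
    simp [Finset.sum_range_succ]
    ring
  have ha : q.coeff 2 ≠ 0 := by
    have := leadingCoeff_ne_zero.mpr hq
    rwa [leadingCoeff, hdeg] at this
  have hd := (quadratic_eq_zero_iff_discrim_eq_sq ha x).mp (by rw [← hexp]; exact hroot)
  rw [discrim] at hd
  nlinarith [sq_nonneg (2 * q.coeff 2 * x + q.coeff 1)]

/-! ## 4. The Newton window -/

/-- `descFactorial` against factorials, cast to `ℝ`: `(j + d).descFactorial d · j! = (j + d)!`. -/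
theorem descFactorial_mul_factorial_cast (j d : ℕ) :
    ((j + d).descFactorial d : ℝ) * (j.factorial : ℝ) = ((j + d).factorial : ℝ) := by
  have := Nat.factorial_mul_descFactorial (Nat.le_add_left d j)
  rw [Nat.add_sub_cancel] at this
  exact_mod_cast (by rw [mul_comm] at this; exact this)

/-- **Newton's inequality (factorial normalisation).**  For a real polynomial `p` with all its roots real and
`1 ≤ k`, `k + 1 ≤ m = natDegree p`:
`coeff (k-1) · coeff (k+1) · ((k-1)! (k+1)! (m-k+1)! (m-k-1)!) ≤ (coeff k · k! (m-k)!)²`. -/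
theorem newton_window (p : ℝ[X]) (h : Multiset.card p.roots = p.natDegree) (k : ℕ) (hk : 1 ≤ k)
    (hkm : k + 1 ≤ p.natDegree) :
    p.coeff (k - 1) * p.coeff (k + 1) *
        (((k - 1).factorial : ℝ) * ((k + 1).factorial : ℝ) * ((p.natDegree - k + 1).factorial : ℝ) *
          ((p.natDegree - k - 1).factorial : ℝ)) ≤
      (p.coeff k * ((k.factorial : ℝ) * ((p.natDegree - k).factorial : ℝ))) ^ 2 := by
  set m := p.natDegree with hm
  by_cases hc0 : p.coeff (k - 1) = 0
  · rw [hc0, zero_mul, zero_mul]; exact sq_nonneg _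
  have hp : p ≠ 0 := by rintro rfl; simp at hc0
  -- step 1: differentiate k-1 times
  set p₁ := derivative^[k - 1] p with hp₁
  have hp₁deg : p₁.natDegree = m - (k - 1) := natDegree_iterate_derivative_eq p (k - 1) (by omega)
  have hp₁rr : Multiset.card p₁.roots = p₁.natDegree := card_roots_iterate_derivative_eq p h (k - 1)
  have hp₁coeff : ∀ j, p₁.coeff j = ((j + (k - 1)).descFactorial (k - 1) : ℝ) * p.coeff (j + (k - 1)) := by
    intro j; rw [hp₁, coeff_iterate_derivative, nsmul_eq_mul]
  have hp₁c0 : p₁.coeff 0 ≠ 0 := by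
    rw [hp₁coeff, zero_add, Nat.descFactorial_self]
    exact mul_ne_zero (by positivity) hc0
  -- step 2: reverse
  set p₂ := p₁.reverse with hp₂
  obtain ⟨hp₂rr, hp₂deg⟩ := card_roots_reverse_eq p₁ hp₁rr hp₁c0
  have hp₂coeff : ∀ j, j ≤ p₁.natDegree → p₂.coeff j = p₁.coeff (p₁.natDegree - j) := by
    intro j hj; rw [hp₂, coeff_reverse, revAt_le hj]
  -- step 3: differentiate m-k-1 times: a quadratic
  set p₃ := derivative^[m - k - 1] p₂ with hp₃
  have hp₃coeff : ∀ j, p₃.coeff j = ((j + (m - k - 1)).descFactorial (m - k - 1) : ℝ) * p₂.coeff (j + (m - k - 1)) := by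
    intro j; rw [hp₃, coeff_iterate_derivative, nsmul_eq_mul]
  have hp₃deg : p₃.natDegree = 2 := by
    rw [hp₃, natDegree_iterate_derivative_eq p₂ (m - k - 1) (by rw [hp₂deg, hp₁deg]; omega), hp₂deg, hp₁deg]
    omega
  have hp₃rr : Multiset.card p₃.roots = p₃.natDegree := card_roots_iterate_derivative_eq p₂ hp₂rr _
  -- the three coefficients of the quadratic
  have hq0 : p₃.coeff 0 = ((m - k - 1).factorial : ℝ) * ((((k + 1).factorial : ℝ)) / 2 * p.coeff (k + 1)) := by
    rw [hp₃coeff, zero_add, Nat.descFactorial_self, hp₂coeff _ (by rw [hp₁deg]; omega), hp₁deg,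
      show m - (k - 1) - (m - k - 1) = 2 by omega, hp₁coeff, show 2 + (k - 1) = k + 1 by omega]
    have h2 : ((k + 1).descFactorial (k - 1) : ℝ) = ((k + 1).factorial : ℝ) / 2 := by
      have := descFactorial_mul_factorial_cast 2 (k - 1)
      rw [show 2 + (k - 1) = k + 1 by omega] at this
      rw [eq_div_iff (by norm_num : (2 : ℝ) ≠ 0), ← this]
      norm_num [Nat.factorial]
    rw [h2]
  have hq1 : p₃.coeff 1 = ((m - k).factorial : ℝ) * ((k.factorial : ℝ) * p.coeff k) := by
    rw [hp₃coeff, hp₂coeff _ (by rw [hp₁deg]; omega), hp₁deg, show m - (k - 1) - (1 + (m - k - 1)) = 1 by omega,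
      hp₁coeff, show 1 + (k - 1) = k by omega]
    have h1 : ((1 + (m - k - 1)).descFactorial (m - k - 1) : ℝ) = ((m - k).factorial : ℝ) := by
      have := descFactorial_mul_factorial_cast 1 (m - k - 1)
      rw [Nat.factorial_one, Nat.cast_one, mul_one, show 1 + (m - k - 1) = m - k by omega] at this
      rw [show 1 + (m - k - 1) = m - k by omega]; exact this
    have h1' : (k.descFactorial (k - 1) : ℝ) = (k.factorial : ℝ) := by
      have := descFactorial_mul_factorial_cast 1 (k - 1)
      rw [Nat.factorial_one, Nat.cast_one, mul_one, show 1 + (k - 1) = k by omega] at this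
      exact this
    rw [h1, h1']
  have hq2 : p₃.coeff 2 = (((m - k + 1).factorial : ℝ) / 2) * ((((k - 1).factorial : ℝ)) * p.coeff (k - 1)) := by
    rw [hp₃coeff, hp₂coeff _ (by rw [hp₁deg]; omega), hp₁deg, show m - (k - 1) - (2 + (m - k - 1)) = 0 by omega,
      hp₁coeff, zero_add, Nat.descFactorial_self]
    have h2 : ((2 + (m - k - 1)).descFactorial (m - k - 1) : ℝ) = ((m - k + 1).factorial : ℝ) / 2 := by
      have := descFactorial_mul_factorial_cast 2 (m - k - 1)
      rw [show 2 + (m - k - 1) = m - k + 1 by omega] at this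
      rw [show 2 + (m - k - 1) = m - k + 1 by omega, eq_div_iff (by norm_num : (2 : ℝ) ≠ 0), ← this]
      norm_num [Nat.factorial]
    rw [h2]
  -- discriminant of the real-rooted quadratic
  have hdisc := four_mul_le_sq_of_card_roots_eq p₃ hp₃deg hp₃rr
  rw [hq0, hq1, hq2] at hdisc
  nlinarith [hdisc]

end NewtonWindow

end Summit.ValiantsHypothesis.ValiantsHypothesis.Theorems.LacunarySymmetroidMatrixDescartes
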